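import Literature.Probability.Percolation.ZdPivotalFourArm
import HarnessLib

/-!
# Pivotal edges of the square crossing: the converse inclusion and the central pivotal sum

Topic `Literature/Probability/Percolation`; proofs only (no definition, no named fact). Sequel of
`ZdPivotalFourArm.lean` in the bottom-up discharge of `Kesten1987_zdKestenRelation`
(`ZdNearCriticalWindow.lean`; Nolin 2008, §7.3, proof of Prop. 32 [EJP: Prop. 34]; Werner 2009,
Lecture 6, proof of Lemma 6.2), bond percolation on `ℤ²`:

* `isPivotal_lrCrossing_of_openConnIn` — **the deterministic converse**: if in `ω ∖ {uv}` and
  inside the square `u` is joined to the left side, `v` to the right side, and there is no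
  left-right crossing, then the edge `uv` is pivotal for `LR([0,N]²)` (the direction used, after
  arm separation and RSW gluing, for the LOWER bound of the pivotal count);
* `card_rectangle`, `card_centralEdges_le` — there are at most `2(N+1)²` lattice edges inside
  the square;
* `sum_real_isPivotal_central_le` — **the central pivotal sum**: summing
  `real_edge_isPivotal_lrCrossing_le` over the lattice edges whose endpoints have coordinates in
  `[d, N-d]`, `Σ_e P_t(e pivotal) ≤ 4 (N+1)² · P_t(fourArmTwoClusters 1 d)` (Nolin, loc. cit.:
  the sites of `[ηL, (1-η)L]²` "each produce a contribution of the same order", upper half, with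
  `d = ηL`; the comparison of `P_t(fourArmTwoClusters 1 d)` with the critical `α₄(1, N)` —
  Kesten's near-critical stability and quasi-multiplicativity — is NOT treated here).
-/

noncomputable section

open MeasureTheory Set
open scoped unitInterval

namespace Literature.Probability.Percolation

open LatticeModels

/-! ### The converse inclusion -/

/-- **Separated clusters make the edge pivotal** (the deterministic converse of
`exists_endpoints_of_isPivotal_lrCrossing`): if, in `ω ∖ {uv}` and inside the square, `u` is
joined to the left side and `v` to the right side while there is no left-right crossing, then
`uv` is pivotal for `LR([0,N]²)` in `ω` — adding the edge joins the two sides (Nolin 2008, §7.3,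
first paragraph; Grimmett 1999, §2.4). [cite: Nolin2008, §7.3 (first paragraph)] -/
theorem isPivotal_lrCrossing_of_openConnIn {N : ℕ} {u v : Site 2} {ω : BondConfig (Site 2)}
    (hne : u ≠ v)
    (hl : ∃ l ∈ leftSide N N, ω \ {s(u, v)} ∈ openConnIn ↑(rectangle N N) l u)
    (hr : ∃ r ∈ rightSide N N, ω \ {s(u, v)} ∈ openConnIn ↑(rectangle N N) v r)
    (hno : ω \ {s(u, v)} ∉ lrCrossing N N) :
    IsPivotal (lrCrossing N N) s(u, v) ω := by
  obtain ⟨l, hl, hlu⟩ := hl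
  obtain ⟨r, hr, hvr⟩ := hr
  refine Or.inl ⟨?_, hno⟩
  have hsub : ω \ {s(u, v)} ⊆ insert s(u, v) ω := sdiff_subset.trans (subset_insert _ ω)
  have hlu' : insert s(u, v) ω ∈ openConnIn ↑(rectangle N N) l u :=
    isUpperSet_openConnIn _ l u hsub hlu
  have hvr' : insert s(u, v) ω ∈ openConnIn ↑(rectangle N N) v r :=
    isUpperSet_openConnIn _ v r hsub hvr
  have huv : insert s(u, v) ω ∈ openConnIn ↑(rectangle N N) u v :=
    openConnIn_of_adj hlu.2.1 hvr.1 (mem_insert _ _) hne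
  exact ⟨l, hl, r, hr, PlanarDuality.openConnIn_trans (PlanarDuality.openConnIn_trans hlu' huv) hvr'⟩

/-! ### Counting lattice edges inside the square -/

/-- `|[0,m] × [0,n] ∩ ℤ²| = (m+1)(n+1)`. [folklore] -/
theorem card_rectangle (m n : ℕ) : (rectangle m n).card = (m + 1) * (n + 1) := by
  rw [rectangle, Pi.card_Icc, Fin.prod_univ_two]
  simp only [Pi.zero_apply, Matrix.cons_val_zero, Matrix.cons_val_one, Int.card_Icc, sub_zero]
  have h1 : ((m : ℤ) + 1).toNat = m + 1 := by omega
  have h2 : ((n : ℤ) + 1).toNat = n + 1 := by omega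
  rw [h1, h2]

open Classical in
/-- **At most `2(N+1)²` lattice edges have both endpoints in the square** `[0,N]²`: every lattice
edge is `{x, x + eᵢ}` for its lower endpoint `x` and a direction `i ∈ {0, 1}`. [folklore] -/
theorem card_edges_rectangle_le (N : ℕ) :
    (((rectangle N N).sym2).filter fun e => e ∈ (zdGraph 2).edgeSet).card ≤ 2 * (N + 1) ^ 2 := by
  set f : Site 2 × Fin 2 → Sym2 (Site 2) := fun xi => s(xi.1, xi.1 + Pi.single xi.2 1) with hf
  have hsub : ((rectangle N N).sym2).filter (fun e => e ∈ (zdGraph 2).edgeSet) ⊆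
      ((rectangle N N) ×ˢ (Finset.univ : Finset (Fin 2))).image f := by
    intro e he
    rw [Finset.mem_filter, Finset.mem_sym2_iff] at he
    obtain ⟨hmem, hE⟩ := he
    obtain ⟨x, i, rfl⟩ := mem_edgeSet_zdGraph_iff.1 hE
    exact Finset.mem_image.2 ⟨(x, i), Finset.mem_product.2 ⟨hmem x (Sym2.mem_mk_left _ _),
      Finset.mem_univ _⟩, rfl⟩
  calc (((rectangle N N).sym2).filter fun e => e ∈ (zdGraph 2).edgeSet).card
      ≤ (((rectangle N N) ×ˢ (Finset.univ : Finset (Fin 2))).image f).card := Finset.card_le_card hsub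
    _ ≤ ((rectangle N N) ×ˢ (Finset.univ : Finset (Fin 2))).card := Finset.card_image_le
    _ = 2 * (N + 1) ^ 2 := by
        rw [Finset.card_product, card_rectangle, Finset.card_univ, Fintype.card_fin]; ring

/-! ### The central pivotal sum -/

open Classical in
/-- **The central pivotal sum is at most `4(N+1)²` four-arm probabilities** (Nolin 2008, §7.3,
proof of Prop. 32: the pivotal sites of the central box `[ηL, (1-η)L]²` are four-arm sites up to
distance `ηL`, upper half; Werner 2009, Lecture 6, proof of Lemma 6.2, interior points): for
`d ≥ 1`, summing `P_t(e pivotal for LR([0,N]²)) ≤ 2 P_t(fourArmTwoClusters 1 d)`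
(`real_edge_isPivotal_lrCrossing_le`) over the lattice edges of the square whose endpoints have
coordinates in `[d, N-d]` (at most `2(N+1)²` of them, `card_edges_rectangle_le`).
[cite: Nolin2008, §7.3, proof of Prop. 34 (arXiv 0711.4948: Prop. 32)] [cite: WernerPCMI2009, Lecture 6, proof of Lemma 6.2] -/
theorem sum_real_isPivotal_central_le (t : unitInterval) {N d : ℕ} (hd : 1 ≤ d) :
    ∑ e ∈ ((rectangle N N).sym2).filter (fun e => e ∈ (zdGraph 2).edgeSet ∧
        ∀ x ∈ e, (d : ℤ) ≤ x 0 ∧ x 0 + d ≤ N ∧ (d : ℤ) ≤ x 1 ∧ x 1 + d ≤ N),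
      (bondPercolation (zdGraph 2) t).real
        {ω | e ∈ (zdGraph 2).edgeSet ∧ IsPivotal (lrCrossing N N) e ω} ≤
      4 * ((N : ℝ) + 1) ^ 2 * (bondPercolation (zdGraph 2) t).real (fourArmTwoClusters 1 d) := by
  set P := bondPercolation (zdGraph 2) t with hP
  set α : ℝ := P.real (fourArmTwoClusters 1 d) with hα
  set F := ((rectangle N N).sym2).filter (fun e => e ∈ (zdGraph 2).edgeSet ∧
    ∀ x ∈ e, (d : ℤ) ≤ x 0 ∧ x 0 + d ≤ N ∧ (d : ℤ) ≤ x 1 ∧ x 1 + d ≤ N) with hF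
  have hterm : ∀ e : Sym2 (Site 2), e ∈ F →
      P.real {ω | e ∈ (zdGraph 2).edgeSet ∧ IsPivotal (lrCrossing N N) e ω} ≤ 2 * α := by
    refine Sym2.ind (fun u v => ?_)
    intro he
    rw [hF, Finset.mem_filter] at he
    obtain ⟨-, hE, hcoord⟩ := he
    have hadj : (zdGraph 2).Adj u v := by rwa [SimpleGraph.mem_edgeSet] at hE
    exact real_edge_isPivotal_lrCrossing_le t hd hadj (hcoord u (Sym2.mem_mk_left u v))
      (hcoord v (Sym2.mem_mk_right u v))
  have hcard : (F.card : ℝ) ≤ 2 * ((N : ℝ) + 1) ^ 2 := by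
    have h1 : F.card ≤ (((rectangle N N).sym2).filter fun e => e ∈ (zdGraph 2).edgeSet).card :=
      Finset.card_le_card (fun e he => by
        rw [hF, Finset.mem_filter] at he
        exact Finset.mem_filter.2 ⟨he.1, he.2.1⟩)
    have h2 := h1.trans (card_edges_rectangle_le N)
    exact_mod_cast h2
  have hα0 : 0 ≤ α := measureReal_nonneg
  calc ∑ e ∈ F, P.real {ω | e ∈ (zdGraph 2).edgeSet ∧ IsPivotal (lrCrossing N N) e ω}
      ≤ ∑ _e ∈ F, 2 * α := Finset.sum_le_sum hterm
    _ = F.card * (2 * α) := by rw [Finset.sum_const, nsmul_eq_mul]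
    _ ≤ 2 * ((N : ℝ) + 1) ^ 2 * (2 * α) := mul_le_mul_of_nonneg_right hcard (by positivity)
    _ = 4 * ((N : ℝ) + 1) ^ 2 * α := by ring

end Literature.Probability.Percolation
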